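import Mathlib.RingTheory.LocalRing.Module
import Mathlib.LinearAlgebra.Dual.Defs
import HarnessLib

/-!
# The adjoint of a degeneracy map is SURJECTIVE when the map is injective modulo the maximal ideal — the last algebraic input of Lemma L1 run for a PAIR (cell `b2b-bsdres`, seat additive-p4 gen 38, line V64/V66; Prop. V64-D step (ii‴))

HONEST FRAMING (verbatim, cell `b2b-bsdres`): the goal of the cell is to DELETE the COMBINATION-SHAPED
residual classes for ALL analytic-rank `≤ 1` curves over `ℚ` — "full BSD formula for every rank `≤ 1`
curve in class `C`" assembled STRICTLY from published theorems — so that the rank-`≤ 1` remainder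
becomes exactly the CONSTRUCTION-SHAPED classes, which are TYPED (missing-input Props), NOT attempted;
this is not "finishing BSD". This file: TOOL theorems (pure module algebra; 0 defs, 0 facts, nothing
booked; X4 stays CONSTRUCTION-SHAPED; no mark moves).

## Why

Memo V64 §4.3 (Prop. V64-D, step (ii‴)) runs Lemma L1 (K112 `OldSupportFactorsThroughDegeneracy`)
for the PAIR of lattices `(H′, H″) = (S₀(M₀′ℓ₁), Q₀(M₀′ℓ₁))` with their perfect pairing and
`(H₁, H₂) = (S₀(M₀′), Q₀(M₀′))`: the adjoint `i₂† : H′ → H₁²` of the `ℓ₁`-degeneracy map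
`i₂ : H₂² → H″` must be SURJECTIVE, and the memo says "⟸ `i₂ ⊗ 𝔽₃` injective + perfect pairings".
This file proves exactly that, over any local ring:

* `dualMap_surjective_of_lTensor_residueField_injective` : `R` local, `l : M →ₗ[R] N` with `M` finite
  and `N` finite free, `k ⊗ l` injective (`k` the residue field) ⟹ `l.dualMap : Dual N → Dual M` is
  surjective. (Mathlib's `IsLocalRing.split_injective_iff_lTensor_residueField_injective` gives a
  retraction `l′ ∘ l = id`; then `φ = (φ ∘ l′) ∘ l`.)
* `adjoint_surjective_of_dualMap_surjective` : if pairings `eA : A′ → Dual A` (injective — perfect on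
  that side) and `eB : B′ → Dual B` (surjective) intertwine `j : B′ → A′` with `l.dualMap`
  (`eA ∘ j = l.dualMap ∘ eB`, i.e. `⟨l a, b′⟩_B = ⟨a, j b′⟩_A` — `j` IS the adjoint), then
  `l.dualMap` surjective ⟹ `j` surjective.
* `adjoint_surjective_of_lTensor_residueField_injective` : the two together — the memo's sentence.

In the application `R = ℤ₃`-algebra `𝕋^{D,θ}_𝔪` is not needed: the statement is over the LOCAL ring
`ℤ₃` (or `𝕋(M₀′)_𝔪`), `l = i₂`, injectivity of `i₂ ⊗ 𝔽₃` is IHARA for `σ(θ)`-forms on `D_{ℓ₂∞}` at `ℓ₁`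
(instrument E17c measures it: `IHARA-mod3-OK` on the `S₀`/`Q₀` lines), and the pairings are the Brandt
pairings of the syntheme module (perfect away from weight-3 θ-points). Nothing here is number theory.

## References (context only; the proofs are elementary)

* K. Ribet, Invent. Math. 100 (1990), §3 (the degeneracy maps and their adjoints on character groups /
  Brandt modules). [cite: Ribet1990, §3]
* A. Wiles, Ann. of Math. 141 (1995), §2. [cite: Wiles1995, §2]
-/

namespace Summit.BirchSwinnertonDyer.Rank1Residual.LevelLowering

open Module

section Adjoint

variable {R : Type*} [CommRing R]

/-- **Split-injective maps have surjective transpose**: if `l′ ∘ l = id` then every functional on `M`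
is of the form `ψ ∘ l` (`ψ = φ ∘ l′`). -/
theorem dualMap_surjective_of_retraction {M N : Type*} [AddCommGroup M] [Module R M]
    [AddCommGroup N] [Module R N] (l : M →ₗ[R] N) (l' : N →ₗ[R] M) (h : l' ∘ₗ l = LinearMap.id) :
    Function.Surjective l.dualMap := by
  intro φ
  refine ⟨φ ∘ₗ l', ?_⟩
  ext x
  rw [LinearMap.dualMap_apply, LinearMap.comp_apply, ← LinearMap.comp_apply (f := l') (g := l), h,
    LinearMap.id_apply]

/-- **Injective modulo the maximal ideal ⟹ surjective transpose.** Over a LOCAL ring `R` with residue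
field `k`, a linear map `l : M → N` with `M` finite and `N` finite free whose reduction `k ⊗ l` is
injective has SURJECTIVE dual map `Dual N → Dual M` (it is a split injection by
`IsLocalRing.split_injective_iff_lTensor_residueField_injective`). Memo V64 §4.3 (ii‴):
"`i₂†` surjective ⟸ `i₂ ⊗ 𝔽₃` injective". [cite: Ribet1990, §3] -/
theorem dualMap_surjective_of_lTensor_residueField_injective [IsLocalRing R] {M N : Type*}
    [AddCommGroup M] [Module R M] [AddCommGroup N] [Module R N] [Module.Finite R M]
    [Module.Finite R N] [Module.Free R N] (l : M →ₗ[R] N)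
    (hl : Function.Injective (l.lTensor (IsLocalRing.ResidueField R))) :
    Function.Surjective l.dualMap := by
  obtain ⟨l', hl'⟩ :=
    (IsLocalRing.split_injective_iff_lTensor_residueField_injective l).mpr hl
  exact dualMap_surjective_of_retraction l l' hl'

/-- **The adjoint with respect to pairings inherits surjectivity from the transpose.** Pairings are
given as maps to duals `eA : A′ → Dual A` (`a′ ↦ ⟨·, a′⟩_A`), `eB : B′ → Dual B`; `j : B′ → A′` is THE
ADJOINT of `l : A → B` when `eA (j b′) = (eB b′) ∘ l` (`⟨a, j b′⟩_A = ⟨l a, b′⟩_B`). If `eA` is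
injective (the `A`-pairing is perfect on the right), `eB` is surjective, and `l.dualMap` is surjective,
then `j` is surjective. -/
theorem adjoint_surjective_of_dualMap_surjective {A A' B B' : Type*} [AddCommGroup A] [Module R A]
    [AddCommGroup A'] [Module R A'] [AddCommGroup B] [Module R B] [AddCommGroup B'] [Module R B']
    (l : A →ₗ[R] B) (eA : A' →ₗ[R] Dual R A) (eB : B' →ₗ[R] Dual R B) (j : B' →ₗ[R] A')
    (hadj : eA ∘ₗ j = l.dualMap ∘ₗ eB) (heA : Function.Injective eA)
    (heB : Function.Surjective eB) (hl : Function.Surjective l.dualMap) :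
    Function.Surjective j := by
  intro a'
  obtain ⟨ψ, hψ⟩ := hl (eA a')
  obtain ⟨b', rfl⟩ := heB ψ
  refine ⟨b', heA ?_⟩
  rw [← LinearMap.comp_apply, hadj, LinearMap.comp_apply, hψ]

/-- **Memo V64 §4.3 (ii‴), the algebraic input in one statement**: over a local ring, for
`l : A → B` with `A` finite, `B` finite free and `k ⊗ l` injective (IHARA mod `𝔪` for the
`σ(θ)`-forms — instrument E17c), and pairings `eA` (injective) / `eB` (surjective) with adjoint `j`
(`eA ∘ j = lᵗ ∘ eB`), the adjoint `j : B′ → A′` is SURJECTIVE. [cite: Ribet1990, §3] -/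
theorem adjoint_surjective_of_lTensor_residueField_injective [IsLocalRing R] {A A' B B' : Type*}
    [AddCommGroup A] [Module R A] [AddCommGroup A'] [Module R A'] [AddCommGroup B] [Module R B]
    [AddCommGroup B'] [Module R B'] [Module.Finite R A] [Module.Finite R B] [Module.Free R B]
    (l : A →ₗ[R] B) (hl : Function.Injective (l.lTensor (IsLocalRing.ResidueField R)))
    (eA : A' →ₗ[R] Dual R A) (eB : B' →ₗ[R] Dual R B) (j : B' →ₗ[R] A')
    (hadj : eA ∘ₗ j = l.dualMap ∘ₗ eB) (heA : Function.Injective eA)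
    (heB : Function.Surjective eB) : Function.Surjective j :=
  adjoint_surjective_of_dualMap_surjective l eA eB j hadj heA heB
    (dualMap_surjective_of_lTensor_residueField_injective l hl)

end Adjoint

end Summit.BirchSwinnertonDyer.Rank1Residual.LevelLowering
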